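import Summits.ValiantsHypothesis.ValiantsHypothesis.Theorems.GrenetZeonDualUnipotentThreeHalvesHeavyTopHalfSpeedDefs
import Summits.ValiantsHypothesis.ValiantsHypothesis.Theorems.GrenetZeonDualUnipotentThreeHalvesHeavyTopBand

/-!
# `GrenetZeon.DualUnipotentThreeHalves` (stmt-ValiantsHypothesis-24318), R2 `HeavyTopLaw`, LINE β `half_speed`: the PROVED part (P)
# — the GLUING LEMMA, the kill / monotonicity lemmas, half-speed ⇒ word-tame, and «a half-speed certificate with `K` given ⇒ WordCheap»

* ★ `halfSpeed_glue` — heights add `+1` per seam, the corner block is free (`gword_glue_blocks`: a non-vanishing corner of a glued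
  word, after any left factor, exhibits a splitting `w = u ++ ℓ :: v` with `gword₁ u ≠ 0`, `gword₂ v ≠ 0`) — the card's first kernel
  deliverable;
* `halfSpeed_mono`, `halfSpeed_anti`, `halfSpeed_zero` (KILL), `gword_eq_word`, `wordTame_of_halfSpeed`,
  `heavyTopWordLaw_of_flagCostWordLaw`;
* ★ `wordCheap_of_halfSpeed` — the «`K` given» shape of stub K0: if the values `N(x)` lie in `U`, the tops `N_lin(v)`, `v ∈ K`, lie in
  `T`, `HalfSpeed Θ U T`, and `(⌊(Θ + n − 1)/2⌋ + 1)·n < dim K`, then `WordCheap n m N` (what K0 must add: the choice of `Θ`, `T` from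
  `HalfSpeedLaw` on `U = ℂ·N(0) + N_lin(ℂ^(n×n))`, `K := N_lin⁻¹ T`, and the budget arithmetic `C₀ = 16C + 16`).

HONEST LABEL: lemmas of a registered line; K0 / K1 / the LAW C⁺, R2 and 24318 stay OPEN; `VP ≠ VNP` is NOT proved; no summit statement is
proved here.  No definitions, no named facts.  (β pen val-port-4 g2; card val-idea-30; critic val-idea-crit-7 g0.)  [folklore]
-/

noncomputable section

-- single-conjunct layout: Sub = Summit, duplicated namespace component intended
set_option linter.dupNamespace false

namespace Summit.ValiantsHypothesis.ValiantsHypothesis.Theorems.GrenetZeon.HalfSpeed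

open MvPolynomial Matrix
open scoped BigOperators
open Summit.ValiantsHypothesis.ValiantsHypothesis.Cruxes.TwoDimCoefficients.DimTwoCases (AffMat IsAffine)
open Summit.ValiantsHypothesis.ValiantsHypothesis.Theorems.GrenetZeon.RadicalSplit

/-- `gword` is the tree's `word` on `Fin m`. -/
theorem gword_eq_word {m : ℕ} (P Q : Matrix (Fin m) (Fin m) ℂ) (w : List Bool) : gword P Q w = word P Q w := rfl

/-! ## Kill, monotonicity, word-tameness -/

/-- Heights off the grid: `HalfSpeed` is monotone in `Θ`. -/
theorem halfSpeed_mono {ι : Type*} [Fintype ι] [DecidableEq ι] {Θ Θ' : ℕ} (h : Θ ≤ Θ') {U T : Set (Matrix ι ι ℂ)}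
    (hU : HalfSpeed Θ U T) : HalfSpeed Θ' U T :=
  fun P hP Q hQ w hw => (hU P hP Q hQ w hw).trans (by omega)

/-- `HalfSpeed` is antitone in both sets of letters. -/
theorem halfSpeed_anti {ι : Type*} [Fintype ι] [DecidableEq ι] {Θ : ℕ} {U U' T T' : Set (Matrix ι ι ℂ)}
    (hU : U' ⊆ U) (hT : T' ⊆ T) (h : HalfSpeed Θ U T) : HalfSpeed Θ U' T' :=
  fun P hP Q hQ w hw => h P (hU hP) Q (hT hQ) w hw

/-- **KILL**: with `T = 0` every space is half-speed of every height (a word with a `Q`-letter is zero). -/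
theorem halfSpeed_zero {ι : Type*} [Fintype ι] [DecidableEq ι] (Θ : ℕ) (U : Set (Matrix ι ι ℂ)) :
    HalfSpeed Θ U {0} := by
  intro P _ Q hQ w hw
  rw [Set.mem_singleton_iff] at hQ
  subst hQ
  suffices h : w.count true = 0 by omega
  rw [List.count_eq_zero]
  intro ht
  apply hw
  unfold gword
  apply List.prod_eq_zero
  rw [List.mem_map]
  exact ⟨true, ht, by simp⟩

/-- **Half-speed ⇒ word-tame** with budget `⌊(Θ + (n−1))/2⌋` (profile `r = c = 1`). -/
theorem wordTame_of_halfSpeed {m : ℕ} (n Θ : ℕ) (P Q : Matrix (Fin m) (Fin m) ℂ)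
    (h : ∀ w : List Bool, word P Q w ≠ 0 → w.count true ≤ Θ + w.count false) :
    WordTame n ((Θ + (n - 1)) / 2) P Q := by
  refine ⟨1, 1, Θ, le_rfl, le_of_eq (by norm_num), fun w hw => ?_⟩
  rw [one_mul, one_mul]
  exact h w hw

/-- **S3b-in-words ⇒ R2-in-words** (drop the heavy-top hypothesis). -/
theorem heavyTopWordLaw_of_flagCostWordLaw (h : FlagCostWordLaw) : HeavyTopWordLaw := by
  obtain ⟨C₀, n₀, h⟩ := h
  exact ⟨C₀, n₀, fun n hn m hm N hN hnil _ => h n hn m hm N hN hnil⟩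

/-! ## The gluing lemma -/

/-- Letters of glued words are glued letters. -/
theorem ite_fromBlocks {ι₁ ι₂ : Type*} (b : Bool) (P₁ Q₁ : Matrix ι₁ ι₁ ℂ) (BP BQ : Matrix ι₁ ι₂ ℂ)
    (P₂ Q₂ : Matrix ι₂ ι₂ ℂ) :
    (if b then Matrix.fromBlocks Q₁ BQ 0 Q₂ else Matrix.fromBlocks P₁ BP 0 P₂) =
      Matrix.fromBlocks (if b then Q₁ else P₁) (if b then BQ else BP) 0 (if b then Q₂ else P₂) := by
  cases b <;> rfl

/-- **Block structure of a glued word**: diagonal blocks are the words of the diagonal letters, the lower corner is `0`, and a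
non-vanishing upper corner (even after a left factor `X`) exhibits a splitting `w = u ++ ℓ :: v` with `X·gword₁ u ≠ 0` and
`gword₂ v ≠ 0` (the corner is the sum over splittings of `gword₁ u · ℓ₁₂ · gword₂ v`). -/
theorem gword_glue_blocks {ι₁ ι₂ : Type*} [Fintype ι₁] [Fintype ι₂] [DecidableEq ι₁] [DecidableEq ι₂]
    (P₁ Q₁ : Matrix ι₁ ι₁ ℂ) (BP BQ : Matrix ι₁ ι₂ ℂ) (P₂ Q₂ : Matrix ι₂ ι₂ ℂ) (w : List Bool) :
    ∃ Cw : Matrix ι₁ ι₂ ℂ,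
      gword (Matrix.fromBlocks P₁ BP 0 P₂) (Matrix.fromBlocks Q₁ BQ 0 Q₂) w =
        Matrix.fromBlocks (gword P₁ Q₁ w) Cw 0 (gword P₂ Q₂ w) ∧
      ∀ X : Matrix ι₁ ι₁ ℂ, X * Cw ≠ 0 →
        ∃ (u : List Bool) (ℓ : Bool) (v : List Bool), w = u ++ ℓ :: v ∧ X * gword P₁ Q₁ u ≠ 0 ∧ gword P₂ Q₂ v ≠ 0 := by
  induction w with
  | nil =>
    refine ⟨0, ?_, fun X hX => absurd (Matrix.mul_zero X) hX⟩
    simp only [gword, List.map_nil, List.prod_nil]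
    exact (Matrix.fromBlocks_one).symm
  | cons b w ih =>
    obtain ⟨Cw, heq, hprop⟩ := ih
    refine ⟨(if b then Q₁ else P₁) * Cw + (if b then BQ else BP) * gword P₂ Q₂ w, ?_, fun X hX => ?_⟩
    · simp only [gword, List.map_cons, List.prod_cons] at heq ⊢
      rw [heq, ite_fromBlocks, Matrix.fromBlocks_multiply]
      simp only [Matrix.mul_zero, Matrix.zero_mul, add_zero, zero_add]
    · -- one of the two summands survives
      by_cases h2 : X * ((if b then BQ else BP) * gword P₂ Q₂ w) = 0
      · -- the seam is later: go through the induction hypothesis with the left factor `X·ℓ₁₁`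
        have h1 : X * (if b then Q₁ else P₁) * Cw ≠ 0 := by
          intro h0
          apply hX
          rw [Matrix.mul_add, h2, add_zero, ← Matrix.mul_assoc, h0]
        obtain ⟨u, ℓ, v, hw, hu, hv⟩ := hprop _ h1
        refine ⟨b :: u, ℓ, v, by rw [hw]; rfl, ?_, hv⟩
        simp only [gword, List.map_cons, List.prod_cons] at hu ⊢
        rwa [← Matrix.mul_assoc]
      · -- the seam is the first letter
        refine ⟨[], b, w, rfl, ?_, ?_⟩
        · simp only [gword, List.map_nil, List.prod_nil, Matrix.mul_one]
          intro hX0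
          apply h2
          rw [hX0, Matrix.zero_mul]
        · intro hv0
          apply h2
          rw [hv0, Matrix.mul_zero, Matrix.mul_zero]

/-- **THE GLUING LEMMA** (card: first kernel deliverable) — heights add `+1` per seam, codimensions add, the corner block is
free: `HalfSpeed Θ₁ U₁ T₁ → HalfSpeed Θ₂ U₂ T₂ → HalfSpeed (Θ₁ + Θ₂ + 1) (glue U₁ U₂) (glue T₁ T₂)`.  Proof: a non-zero glued word
has a non-zero diagonal block (then one height suffices) or a non-zero corner, which exhibits a splitting `w = u ++ ℓ :: v` with
`gword₁ u ≠ 0`, `gword₂ v ≠ 0` (`gword_glue_blocks`); the seam letter `ℓ` adds at most `1`. -/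
theorem halfSpeed_glue {ι₁ ι₂ : Type*} [Fintype ι₁] [Fintype ι₂] [DecidableEq ι₁] [DecidableEq ι₂] (Θ₁ Θ₂ : ℕ)
    (U₁ T₁ : Set (Matrix ι₁ ι₁ ℂ)) (U₂ T₂ : Set (Matrix ι₂ ι₂ ℂ)) (h₁ : HalfSpeed Θ₁ U₁ T₁) (h₂ : HalfSpeed Θ₂ U₂ T₂) :
    HalfSpeed (Θ₁ + Θ₂ + 1) (glue U₁ U₂) (glue T₁ T₂) := by
  rintro P ⟨P₁, hP₁, P₂, hP₂, BP, rfl⟩ Q ⟨Q₁, hQ₁, Q₂, hQ₂, BQ, rfl⟩ w hw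
  obtain ⟨Cw, heq, hprop⟩ := gword_glue_blocks P₁ Q₁ BP BQ P₂ Q₂ w
  rw [heq] at hw
  by_cases hG₁ : gword P₁ Q₁ w = 0
  · by_cases hG₂ : gword P₂ Q₂ w = 0
    · by_cases hC : Cw = 0
      · exact absurd (by rw [hG₁, hG₂, hC, Matrix.fromBlocks_zero]) hw
      · obtain ⟨u, ℓ, v, rfl, hu, hv⟩ := hprop 1 (by rwa [Matrix.one_mul])
        rw [Matrix.one_mul] at hu
        have cu := h₁ P₁ hP₁ Q₁ hQ₁ u hu
        have cv := h₂ P₂ hP₂ Q₂ hQ₂ v hv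
        simp only [List.count_append, List.count_cons]
        split_ifs <;> omega
    · have cw := h₂ P₂ hP₂ Q₂ hQ₂ w hG₂
      omega
  · have cw := h₁ P₁ hP₁ Q₁ hQ₁ w hG₁
    omega

/-! ## A half-speed certificate with the direction space given is `WordCheap` -/

/-- ★ **Half-speed certificate, `K` given ⇒ `WordCheap`.**  If every value `N(x)` of the pencil lies in `U`, every top `N_lin(v)`,
`v ∈ K`, lies in `T`, the pair is half-speed of height `Θ`, and `(⌊(Θ + n − 1)/2⌋ + 1)·n < dim K`, then `WordCheap n m N`. [this file] -/
theorem wordCheap_of_halfSpeed {n m : ℕ} (N : AffMat n m) (U T : Set (Matrix (Fin m) (Fin m) ℂ)) (Θ : ℕ)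
    (hHS : HalfSpeed Θ U T) (hU : ∀ x : Fin n × Fin n → ℂ, N.map (MvPolynomial.eval x) ∈ U)
    (K : Submodule ℂ (Fin n × Fin n → ℂ)) (hK : ∀ v ∈ K, linPart N v ∈ T)
    (hdim : ((Θ + (n - 1)) / 2 + 1) * n < Module.finrank ℂ K) :
    WordCheap n m N := by
  refine ⟨K, (Θ + (n - 1)) / 2, hdim, fun x v hv => ?_⟩
  exact wordTame_of_halfSpeed n Θ _ _ fun w hw => hHS _ (hU x) _ (hK v hv) w (by rwa [gword_eq_word])

end Summit.ValiantsHypothesis.ValiantsHypothesis.Theorems.GrenetZeon.HalfSpeed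

end
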